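import Mathlib
import HarnessLib

/-!
# Stub T4 of line `blowdown-kills-pitch` of crux `SymmetricLiouville`: the crossing-time integral

Crux stmt-NavierStokesRegularity-4053, route `SymmetryModuliCount`.

Pure one-dimensional calculus (no PDE). For `s₀ > 0`, `X > 0` and a slope `ρ` with `|ρ| · 4√s₀ ≤ X`,

  `∫_{s > s₀} s^{-1/2} (s − s₀ + (X − ρ√s)²)^{-1} ds ≤ 8π / X`,

stated in `ℝ≥0∞`. In the symmetry-free Oseen bootstrap (`s = −τ` is past time, `s₀ = −t`,
`X = ‖x‖`) the source sheet `{y · x̂ = ρ√s}` crosses the observation point at `√s = X/ρ`; this is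
the statement that the time integral across the crossing is `O(1/X)` uniformly in the sheet.

Proof. Write `u = √s`, `u₀ = √s₀`, `D(u) = u² − u₀² + (X − ρu)²`. Pointwise on `u > u₀`,
`1/D ≤ 1/Q₁ + 1/Q₂` with the two everywhere-positive quadratics `Q₁(u) = (u − u₀)² + X²/4` (used
where `ρu ≤ X/2`, since `u² − u₀² ≥ (u − u₀)²`) and `Q₂(u) = u²/4 + (X − ρu)²` (used where
`ρu > X/2`, which by `|ρ|u₀ ≤ X/4` forces `u > 2u₀`, whence `u² − u₀² ≥ 3u²/4`). Both `Qᵢ` are of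
the form `A u² + B u + (X² + B²)/(4A)` with `A > 0`, and for such a quadratic
`s ↦ (4/X) arctan ((2A√s + B)/X)` is an antiderivative of `s ↦ (√s)⁻¹ (A s + B√s + (X² + B²)/(4A))⁻¹`
on `s > 0` with values in `(−2π/X, 2π/X)`; the fundamental theorem of calculus on `(s₀, ∞)`
(`MeasureTheory.integral_Ioi_of_hasDerivAt_of_nonneg'`) bounds each piece by `4π/X`.
-/

set_option linter.dupNamespace false

open MeasureTheory Set Real Filter
open scoped ENNReal Topology

namespace Summit.NavierStokesRegularity.NavierStokesRegularity.Theorems.SymmetryModuliCountSymmetricLiouville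

/-- **The one-dimensional template integral.** For `A > 0`, `δ > 0`, `B ∈ ℝ` and `s₀ > 0`,
`∫_{s > s₀} (√s)⁻¹ (A s + B √s + (δ² + B²)/(4A))⁻¹ ds ≤ 4π/δ`: the function
`s ↦ (4/δ) arctan ((2A√s + B)/δ)` is an antiderivative of the (nonnegative) integrand on `s > 0`,
it tends to `2π/δ` at `+∞` and is `> −2π/δ` at `s₀`. -/
theorem lintegral_Ioi_invSqrt_mul_invQuadratic_le {A B δ s₀ : ℝ} (hA : 0 < A) (hδ : 0 < δ)
    (hs₀ : 0 < s₀) :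
    ∫⁻ s in Ioi s₀, ENNReal.ofReal
        ((Real.sqrt s)⁻¹ * (A * s + B * Real.sqrt s + (δ ^ 2 + B ^ 2) / (4 * A))⁻¹) ≤
      ENNReal.ofReal (4 * π / δ) := by
  -- the quadratic is a positive completed square
  have hQ : ∀ u : ℝ, 0 < A * u ^ 2 + B * u + (δ ^ 2 + B ^ 2) / (4 * A) := fun u => by
    have h : A * u ^ 2 + B * u + (δ ^ 2 + B ^ 2) / (4 * A) =
        A * (u + B / (2 * A)) ^ 2 + δ ^ 2 / (4 * A) := by
      field_simp
      ring
    rw [h]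
    positivity
  -- the antiderivative `s ↦ (4/δ) arctan ((2A√s + B)/δ)` on `s > 0`
  have hderiv : ∀ x ∈ Ici s₀, HasDerivAt (fun s => 4 / δ * arctan ((2 * A * Real.sqrt s + B) / δ))
      ((Real.sqrt x)⁻¹ * (A * x + B * Real.sqrt x + (δ ^ 2 + B ^ 2) / (4 * A))⁻¹) x := by
    intro x hx
    have hxpos : 0 < x := hs₀.trans_le hx
    obtain ⟨u, hu, rfl⟩ : ∃ u : ℝ, 0 < u ∧ u ^ 2 = x :=
      ⟨Real.sqrt x, Real.sqrt_pos.2 hxpos, Real.sq_sqrt hxpos.le⟩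
    have hux : Real.sqrt (u ^ 2) = u := Real.sqrt_sq hu.le
    have h1 : HasDerivAt (fun s => (2 * A * Real.sqrt s + B) / δ)
        (2 * A * (1 / (2 * Real.sqrt (u ^ 2))) / δ) (u ^ 2) :=
      (((Real.hasDerivAt_sqrt (pow_pos hu 2).ne').const_mul (2 * A)).add_const B).div_const δ
    refine ((h1.arctan).const_mul (4 / δ)).congr_deriv ?_
    rw [hux]
    have hune : u ≠ 0 := hu.ne'
    have hδne : δ ≠ 0 := hδ.ne'
    have hAne : A ≠ 0 := hA.ne'
    have eq1 : 1 + ((2 * A * u + B) / δ) ^ 2 = (δ ^ 2 + (2 * A * u + B) ^ 2) / δ ^ 2 := by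
      field_simp
    have eq2 : A * u ^ 2 + B * u + (δ ^ 2 + B ^ 2) / (4 * A) =
        (δ ^ 2 + (2 * A * u + B) ^ 2) / (4 * A) := by
      field_simp
      ring
    rw [eq1, eq2]
    have hW : δ ^ 2 + (2 * A * u + B) ^ 2 ≠ 0 := by positivity
    field_simp
  -- the integrand is nonnegative on `s > s₀`
  have hpos : ∀ x ∈ Ioi s₀,
      0 ≤ (Real.sqrt x)⁻¹ * (A * x + B * Real.sqrt x + (δ ^ 2 + B ^ 2) / (4 * A))⁻¹ := by
    intro x hx
    have hxpos : 0 < x := hs₀.trans hx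
    have hQx := hQ (Real.sqrt x)
    rw [Real.sq_sqrt hxpos.le] at hQx
    positivity
  -- the antiderivative tends to `2π/δ` at `+∞`
  have hlim : Tendsto (fun s => 4 / δ * arctan ((2 * A * Real.sqrt s + B) / δ)) atTop
      (𝓝 (4 / δ * (π / 2))) := by
    have h1 : Tendsto (fun s => (2 * A * Real.sqrt s + B) / δ) atTop atTop :=
      (tendsto_atTop_add_const_right atTop B
        (Real.tendsto_sqrt_atTop.const_mul_atTop (by positivity))).atTop_div_const hδ
    exact ((Real.tendsto_arctan_atTop.mono_right nhdsWithin_le_nhds).comp h1).const_mul (4 / δ)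
  have hint := integrableOn_Ioi_deriv_of_nonneg' hderiv hpos hlim
  have hval := integral_Ioi_of_hasDerivAt_of_nonneg' hderiv hpos hlim
  have hnn : 0 ≤ᵐ[volume.restrict (Ioi s₀)] fun x =>
      (Real.sqrt x)⁻¹ * (A * x + B * Real.sqrt x + (δ ^ 2 + B ^ 2) / (4 * A))⁻¹ := by
    rw [Filter.EventuallyLE, ae_restrict_iff' measurableSet_Ioi]
    exact ae_of_all _ fun x hx => hpos x hx
  refine (ofReal_integral_eq_lintegral_ofReal hint hnn).symm.trans_le ?_
  rw [hval]
  refine ENNReal.ofReal_le_ofReal ?_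
  have hat := Real.neg_pi_div_two_lt_arctan ((2 * A * Real.sqrt s₀ + B) / δ)
  have h4 : 0 ≤ 4 / δ := by positivity
  have key : 4 / δ * (π / 2 - arctan ((2 * A * Real.sqrt s₀ + B) / δ)) ≤ 4 / δ * π :=
    mul_le_mul_of_nonneg_left (by linarith) h4
  calc _ = 4 / δ * (π / 2 - arctan ((2 * A * Real.sqrt s₀ + B) / δ)) := by ring
    _ ≤ 4 / δ * π := key
    _ = 4 * π / δ := by ring

/-- **The pointwise splitting, in the variable `u = √s`.** For `0 ≤ u₀ < u`, `X > 0` and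
`|ρ| · 4u₀ ≤ X`, with `D = u² − u₀² + (X − ρu)²`, `Q₁ = (u − u₀)² + X²/4` and `Q₂ = u²/4 + (X − ρu)²`
(written in the form `A u² + B u + (X² + B²)/(4A)`): `D⁻¹ ≤ Q₁⁻¹ + Q₂⁻¹`. If `ρu ≤ X/2` then
`D ≥ Q₁ > 0`; otherwise `ρ > 0` and `u > 2u₀`, so `u² − u₀² ≥ 3u²/4` and `D ≥ Q₂ > 0`. -/
theorem inv_crossingQuadratic_le_add {u u₀ X ρ : ℝ} (hu₀ : 0 ≤ u₀) (hu : u₀ < u) (hX : 0 < X)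
    (hρ : |ρ| * (4 * u₀) ≤ X) :
    (u ^ 2 - u₀ ^ 2 + (X - ρ * u) ^ 2)⁻¹ ≤
      (1 * u ^ 2 + -2 * u₀ * u + (X ^ 2 + (-2 * u₀) ^ 2) / (4 * 1))⁻¹ +
        ((1 / 4 + ρ ^ 2) * u ^ 2 + -2 * ρ * X * u +
          (X ^ 2 + (-2 * ρ * X) ^ 2) / (4 * (1 / 4 + ρ ^ 2)))⁻¹ := by
  have hu0 : 0 < u := hu₀.trans_lt hu
  have ha : (1 / 4 + ρ ^ 2 : ℝ) ≠ 0 := by positivity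
  have e1 : 1 * u ^ 2 + -2 * u₀ * u + (X ^ 2 + (-2 * u₀) ^ 2) / (4 * 1) =
      (u - u₀) ^ 2 + X ^ 2 / 4 := by ring
  have e2 : (1 / 4 + ρ ^ 2) * u ^ 2 + -2 * ρ * X * u +
      (X ^ 2 + (-2 * ρ * X) ^ 2) / (4 * (1 / 4 + ρ ^ 2)) = u ^ 2 / 4 + (X - ρ * u) ^ 2 := by
    field_simp
    ring
  rw [e1, e2]
  have hQ1 : 0 < (u - u₀) ^ 2 + X ^ 2 / 4 := by positivity
  have hQ2 : 0 < u ^ 2 / 4 + (X - ρ * u) ^ 2 := by positivity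
  rcases le_or_gt (ρ * u) (X / 2) with h | h
  · -- before the crossing: `(X - ρu)² ≥ X²/4` and `u² - u₀² ≥ (u - u₀)²`
    have hD : (u - u₀) ^ 2 + X ^ 2 / 4 ≤ u ^ 2 - u₀ ^ 2 + (X - ρ * u) ^ 2 := by
      nlinarith [mul_nonneg hu₀ (sub_nonneg.2 hu.le),
        mul_nonneg (by linarith : (0 : ℝ) ≤ X - ρ * u - X / 2)
          (by linarith : (0 : ℝ) ≤ X - ρ * u + X / 2)]
    exact (inv_anti₀ hQ1 hD).trans (le_add_of_nonneg_right (inv_nonneg.2 hQ2.le))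
  · -- past the half-way point: `ρ > 0`, `u > 2u₀`, `u² - u₀² ≥ 3u²/4 ≥ u²/4`
    have hρ0 : 0 < ρ := by
      by_contra hcon
      push Not at hcon
      nlinarith [mul_nonneg (neg_nonneg.2 hcon) hu0.le]
    have h2 : 2 * u₀ < u := by
      by_contra hcon
      push Not at hcon
      have h3 : ρ * u ≤ ρ * (2 * u₀) := mul_le_mul_of_nonneg_left hcon hρ0.le
      rw [abs_of_pos hρ0] at hρ
      linarith
    have hD : u ^ 2 / 4 + (X - ρ * u) ^ 2 ≤ u ^ 2 - u₀ ^ 2 + (X - ρ * u) ^ 2 := by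
      nlinarith [mul_nonneg (by linarith : (0 : ℝ) ≤ u - 2 * u₀)
        (by linarith : (0 : ℝ) ≤ u + 2 * u₀)]
    exact (inv_anti₀ hQ2 hD).trans (le_add_of_nonneg_left (inv_nonneg.2 hQ1.le))

/-- **The pointwise splitting of the crossing-time integrand, in `ℝ≥0∞`.** For `0 < s₀ < s`,
`X > 0` and `|ρ| · 4√s₀ ≤ X`, the integrand `(√s)⁻¹ (s − s₀ + (X − ρ√s)²)⁻¹` is at most the sum
of the two template integrands `(√s)⁻¹ (A s + B√s + (X² + B²)/(4A))⁻¹` with `(A, B) = (1, −2√s₀)`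
and `(A, B) = (1/4 + ρ², −2ρX)` (`inv_crossingQuadratic_le_add` at `u = √s`, `u₀ = √s₀`, and
`ofReal (a + b) ≤ ofReal a + ofReal b`). -/
theorem ofReal_crossingIntegrand_le_add {s₀ s X ρ : ℝ} (hs₀ : 0 < s₀) (hs : s₀ < s) (hX : 0 < X)
    (hρ : |ρ| * (4 * Real.sqrt s₀) ≤ X) :
    ENNReal.ofReal ((Real.sqrt s)⁻¹ * (s - s₀ + (X - ρ * Real.sqrt s) ^ 2)⁻¹) ≤
      ENNReal.ofReal ((Real.sqrt s)⁻¹ *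
          (1 * s + -2 * Real.sqrt s₀ * Real.sqrt s +
            (X ^ 2 + (-2 * Real.sqrt s₀) ^ 2) / (4 * 1))⁻¹) +
        ENNReal.ofReal ((Real.sqrt s)⁻¹ *
          ((1 / 4 + ρ ^ 2) * s + -2 * ρ * X * Real.sqrt s +
            (X ^ 2 + (-2 * ρ * X) ^ 2) / (4 * (1 / 4 + ρ ^ 2)))⁻¹) := by
  have hs0 : 0 ≤ s := hs₀.le.trans hs.le
  have hu : Real.sqrt s₀ < Real.sqrt s := Real.sqrt_lt_sqrt hs₀.le hs
  have key := inv_crossingQuadratic_le_add (Real.sqrt_nonneg s₀) hu hX hρ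
  rw [Real.sq_sqrt hs₀.le, Real.sq_sqrt hs0] at key
  have key' := mul_le_mul_of_nonneg_left key (inv_nonneg.2 (Real.sqrt_nonneg s))
  rw [mul_add] at key'
  exact (ENNReal.ofReal_le_ofReal key').trans ENNReal.ofReal_add_le

/-- **Stub T4 — the crossing-time integral of one sheet.** There is an absolute constant `A > 0`
(here `A = 8π`) such that for all `s₀ > 0`, `X > 0` and `ρ` with `|ρ| · 4√s₀ ≤ X`,
`∫⁻_{s > s₀} ofReal ((√s)⁻¹ (s − s₀ + (X − ρ√s)²)⁻¹) ≤ ofReal (A / X)`: split the integrand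
pointwise (`ofReal_crossingIntegrand_le_add`) and bound each of the two template integrals by
`4π/X` (`lintegral_Ioi_invSqrt_mul_invQuadratic_le` with `δ = X`). -/
theorem stub_crossingTimeIntegral :
    ∃ A : ℝ, 0 < A ∧ ∀ s₀ : ℝ, 0 < s₀ → ∀ X : ℝ, 0 < X → ∀ ρ : ℝ, |ρ| * (4 * Real.sqrt s₀) ≤ X →
      ∫⁻ s in Set.Ioi s₀, ENNReal.ofReal ((Real.sqrt s)⁻¹ * (s - s₀ + (X - ρ * Real.sqrt s) ^ 2)⁻¹) ≤
        ENNReal.ofReal (A / X) := by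
  refine ⟨8 * π, by positivity, fun s₀ hs₀ X hX ρ hρ => ?_⟩
  have H₁ := lintegral_Ioi_invSqrt_mul_invQuadratic_le (A := 1) (B := -2 * Real.sqrt s₀)
    one_pos hX hs₀
  have H₂ := lintegral_Ioi_invSqrt_mul_invQuadratic_le (A := 1 / 4 + ρ ^ 2) (B := -2 * ρ * X)
    (by positivity) hX hs₀
  have hmeas : Measurable fun s : ℝ => ENNReal.ofReal ((Real.sqrt s)⁻¹ *
      (1 * s + -2 * Real.sqrt s₀ * Real.sqrt s + (X ^ 2 + (-2 * Real.sqrt s₀) ^ 2) / (4 * 1))⁻¹) := by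
    fun_prop
  refine (setLIntegral_mono' measurableSet_Ioi
    fun s hs => ofReal_crossingIntegrand_le_add hs₀ hs hX hρ).trans ?_
  rw [lintegral_add_left hmeas]
  refine (add_le_add H₁ H₂).trans_eq ?_
  rw [← ENNReal.ofReal_add (by positivity) (by positivity)]
  congr 1
  ring

end Summit.NavierStokesRegularity.NavierStokesRegularity.Theorems.SymmetryModuliCountSymmetricLiouville
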